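import Literature.MathematicalPhysics.QuantumFieldTheory.Balaban1983to89.Beta.RateCertificate

/-!
# `BalabanUV.Beta.FixedPointIdentification` — the ROUTE ALGEBRA of road «FP» (fixed-point uniqueness) for binder row D1:
# additivity on the powers of the blocking factor + leading-log asymptotics ⇒ the EXACT one-loop value at fixed `Lc`;
# a constant sequence with a linear drift bound equals the slope; rate + value ⇒ `OneLoopDrift` (road A2's last step by name)

HONEST FRAMING (cell contract, verbatim): «discharging `BetaPertH` makes Bałaban's UV stability UNCONDITIONAL — a real
constructive-QFT result; it is NOT the continuum limit and NOT the Clay problem.»  THIS MODULE DISCHARGES NOTHING of it: it is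
elementary real analysis (Archimedean property, `Real.log_pow`, a geometric series by name) about ABSTRACT sequences.  It is the
kernel-checked COMPOSITION of the ROUND-2 co-owner road «FP» for row D1 (unit `b2b-balaban-beta-d1-p3`, skeleton
`HOME/beta/skeletons/D1-b2b-balaban-beta-d1-p3.md`): every analytic input of that road is a HYPOTHESIS here, never a fact.

ABSOLUTE RULE (cell, verbatim): «No internally-minted statement may enter as a cited fact. Every hypothesis is either kernel-proved in
this package or a verbatim quotation of a PUBLISHED theorem with page reference.»  Nothing is cited or asserted below; no `def … : Prop`
hypothesis shape refers to Bałaban's objects.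

THE ROAD, IN ONE PARAGRAPH (what the hypotheses stand for; none of this is asserted here).  Road A2 (asym1,
`Summits/…/Beta/HessKerDressedUnitsWall.d1Drift_JsBalOf_iff_of_cauchy_unit` and its rooted / co-dressed variants) reduces the wall
literal `OneStepKernelFamily.D1Drift Lc Js N μ ν` to (CONV-C-Cauchy) data (binder row G-an2-4) plus ONE identity `hident`:
`secondMoment T∞ μ ν = B12Normalization.stepBal N Lc` at the constructed limit kernel `T∞` (GAPS O-asym1-7).  Road «FP» reads `T∞` as the
one-loop vacuum polarization of the Gaussian FIXED-POINT («perfect») `Lc`-step and proves `hident` WITHOUT evaluating any fixed-`Lc` sum: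
writing `f n` for the (1.22)-type second moment of the perfect step with blocking factor `n`, SCALE INVARIANCE of the fixed point (one-loop
Fubini for two consecutive perfect steps + transport invariance of the marginal coefficient + the B12 §5 symmetry class) gives the
STEP LAW `f (Lc^(m+1)) = f (Lc^m) + f Lc` (§2: hence `f (Lc^m) = m · f Lc`), and the leading-log asymptotics of the EXPLICIT perfect
one-shot give `|f (Lc^m) − stepBal N (Lc^m)| ≤ C` (or only `o(m)`) (§3: hence `f Lc = stepBal N Lc` EXACTLY — «uniqueness does the
identification»); with the geometric rate of the actual step coefficients to `f Lc` this is `D1Drift` (§4–§5).  §1 is the same fact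
read on the cell's composed road run AT the fixed point: a CONSTANT coefficient sequence obeying `Drift.OneLoopDrift s A` IS `s`.

CONTENT (all [folklore]-grade real analysis; no new `def` except the hypothesis-free abbreviation-free statements):
* §1 `eq_of_nat_mul_sub_bounded` (|m·(c − s)| ≤ C for all m ⇒ c = s), `const_eq_of_oneLoopDrift`.
* §2 `pow_law_of_step_law` (the step law on powers ⇒ `f (Lc^m) = m · f Lc`, `m ≥ 1`).
* §3 `stepBal_natPow` (`stepBal N (Lc^m) = m · stepBal N Lc`), `value_eq_of_pow_law_bounded`, `value_eq_of_pow_law_littleO`,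
  `value_eq_stepBal_of_step_law_bounded`, `value_eq_stepBal_of_step_law_littleO`.
* §4 `oneLoopDrift_of_geomRate_eq` (= `RateCertificate.GeomRate.drift` after rewriting the limit).
* §5 `oneLoopDrift_stepBal_of_rate_step_law_bounded` / `_littleO` — THE ROUTE THEOREM: rate + step law + asymptotics ⇒
  `OneLoopDrift (stepBal N Lc) (c₀/(1−θ)) β0`.
NOT HERE (the road's leaves, all OPEN, see the skeleton): the dictionary «`T∞` = perfect polarization», the fixed-point / semigroup
identities, the one-loop Fubini, the symmetry class and transport invariance at the fixed point, the perfect one-shot asymptotics,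
(CONV-C-Cauchy).  NOT BetaPertH, NOT continuum, NOT Clay.
-/

namespace Summit.QuantumFields.BalabanUV.Beta.FixedPointIdentification

open Filter Topology
open Literature.MathematicalPhysics.QuantumFieldTheory.Balaban1983to89
open Literature.MathematicalPhysics.QuantumFieldTheory.Balaban1983to89.Beta
open Literature.MathematicalPhysics.QuantumFieldTheory.Balaban1983to89.Beta.RateCertificate (GeomRate)
open Literature.MathematicalPhysics.QuantumFieldTheory.Balaban1983to89.Beta.Drift (OneLoopDrift)
open B12Normalization (stepBal)

/-! ## §1 A linearly growing quantity that stays bounded vanishes; a constant drift-bounded sequence is the slope -/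

/-- [folklore] If `|m · (c − s)| ≤ C` for every natural `m`, then `c = s` (Archimedean property). -/
theorem eq_of_nat_mul_sub_bounded {c s C : ℝ} (h : ∀ m : ℕ, |(m : ℝ) * (c - s)| ≤ C) : c = s := by
  by_contra hne
  have hpos : 0 < |c - s| := abs_pos.mpr (sub_ne_zero.mpr hne)
  obtain ⟨m, hm⟩ := exists_nat_gt (C / |c - s|)
  have hlt : C < (m : ℝ) * |c - s| := (div_lt_iff₀ hpos).mp hm
  have hle := h m
  rw [abs_mul, Nat.abs_cast] at hle
  exact absurd hle (not_le.mpr hlt)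

/-- [folklore] **THE COMPOSED ROAD AT THE FIXED POINT FORCES THE VALUE.**  A CONSTANT coefficient sequence `j ↦ c` whose partial sums
obey the drift bound `|Σ_{j<k} c − s·k| ≤ A` for all `k` (`Drift.OneLoopDrift s A (fun _ => c)`) has `c = s`. -/
theorem const_eq_of_oneLoopDrift {s A c : ℝ} (h : OneLoopDrift s A (fun _ => c)) : c = s := by
  refine eq_of_nat_mul_sub_bounded (C := A) fun m => ?_
  have hm := h m
  simp only [Finset.sum_const, Finset.card_range, nsmul_eq_mul] at hm
  have : (m : ℝ) * (c - s) = (m : ℝ) * c - s * (m : ℝ) := by ring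
  rw [this]
  exact hm

/-! ## §2 The step law on the powers of the blocking factor gives the power law -/

/-- [folklore] **STEP LAW ⇒ POWER LAW.**  If `f (Lc^(m+1)) = f (Lc^m) + f Lc` for every `m ≥ 1` (one perfect `Lc`-step composed with a
perfect `Lc^m`-step IS the perfect `Lc^(m+1)`-step, read at the level of the one-loop marginal coefficient), then
`f (Lc^m) = m · f Lc` for every `m ≥ 1`. -/
theorem pow_law_of_step_law {f : ℕ → ℝ} {Lc : ℕ} (hstep : ∀ m : ℕ, 1 ≤ m → f (Lc ^ (m + 1)) = f (Lc ^ m) + f Lc) :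
    ∀ m : ℕ, 1 ≤ m → f (Lc ^ m) = (m : ℝ) * f Lc := by
  intro m hm
  induction m with
  | zero => exact absurd hm (by norm_num)
  | succ n ih =>
    rcases Nat.eq_zero_or_pos n with h0 | hpos
    · subst h0; simp
    · rw [hstep n hpos, ih hpos]; push_cast; ring

/-! ## §3 Power law + leading-log asymptotics ⇒ the exact value at fixed `Lc` -/

/-- [folklore] `stepBal N (Lc^m) = m · stepBal N Lc` (`stepBal N L = (11N²/(12π²))·log L` and `log (L^m) = m log L`). -/
theorem stepBal_natPow (N : ℝ) (Lc m : ℕ) : stepBal N ((Lc : ℝ) ^ m) = (m : ℝ) * stepBal N Lc := by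
  rw [B12Normalization.stepBal_eq, B12Normalization.stepBal_eq, Real.log_pow]
  ring

/-- [folklore] **POWER LAW + BOUNDED DEFECT ⇒ EXACT VALUE.**  If `f (Lc^m) = m · f Lc` for `m ≥ 1` and `|f (Lc^m) − m · v| ≤ C` for
`m ≥ 1`, then `f Lc = v`. -/
theorem value_eq_of_pow_law_bounded {f : ℕ → ℝ} {Lc : ℕ} {v C : ℝ} (hpow : ∀ m : ℕ, 1 ≤ m → f (Lc ^ m) = (m : ℝ) * f Lc)
    (hasym : ∀ m : ℕ, 1 ≤ m → |f (Lc ^ m) - (m : ℝ) * v| ≤ C) : f Lc = v := by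
  refine eq_of_nat_mul_sub_bounded (C := max C 0) fun m => ?_
  rcases Nat.eq_zero_or_pos m with h0 | hpos
  · subst h0; simp
  · have h1 : 1 ≤ m := hpos
    have := hasym m h1
    rw [hpow m h1] at this
    rw [mul_sub]
    exact this.trans (le_max_left _ _)

/-- [folklore] **POWER LAW + `o(m)` DEFECT ⇒ EXACT VALUE** (the weakest asymptotic input the road can use: the MEAN law). -/
theorem value_eq_of_pow_law_littleO {f : ℕ → ℝ} {Lc : ℕ} {v : ℝ} (hpow : ∀ m : ℕ, 1 ≤ m → f (Lc ^ m) = (m : ℝ) * f Lc)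
    (hasym : Tendsto (fun m : ℕ => (f (Lc ^ m) - (m : ℝ) * v) / (m : ℝ)) atTop (𝓝 0)) : f Lc = v := by
  have hev : (fun m : ℕ => (f (Lc ^ m) - (m : ℝ) * v) / (m : ℝ)) =ᶠ[atTop] fun _ => f Lc - v := by
    filter_upwards [eventually_ge_atTop 1] with m hm
    have hm' : (m : ℝ) ≠ 0 := by exact_mod_cast (Nat.one_le_iff_ne_zero.mp hm)
    rw [hpow m hm, ← mul_sub, mul_div_cancel_left₀ _ hm']
  have hconst : Tendsto (fun _ : ℕ => f Lc - v) atTop (𝓝 0) := hasym.congr' hev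
  have := tendsto_const_nhds_iff.mp hconst
  linarith

/-- [folklore] **STEP LAW + BOUNDED LOG DEFECT ⇒ `f Lc = stepBal N Lc`.**  The hypotheses of road «FP» in `stepBal` currency: the step law
on powers (scale invariance of the fixed point) and `|f (Lc^m) − stepBal N (Lc^m)| ≤ C` (leading-log asymptotics of the perfect one-shot,
with bounded defect). -/
theorem value_eq_stepBal_of_step_law_bounded {f : ℕ → ℝ} {Lc : ℕ} {N C : ℝ}
    (hstep : ∀ m : ℕ, 1 ≤ m → f (Lc ^ (m + 1)) = f (Lc ^ m) + f Lc)
    (hasym : ∀ m : ℕ, 1 ≤ m → |f (Lc ^ m) - stepBal N ((Lc : ℝ) ^ m)| ≤ C) : f Lc = stepBal N Lc :=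
  value_eq_of_pow_law_bounded (pow_law_of_step_law hstep) fun m hm => by rw [← stepBal_natPow]; exact hasym m hm

/-- [folklore] **STEP LAW + `o(m)` LOG DEFECT ⇒ `f Lc = stepBal N Lc`** (mean-law form). -/
theorem value_eq_stepBal_of_step_law_littleO {f : ℕ → ℝ} {Lc : ℕ} {N : ℝ}
    (hstep : ∀ m : ℕ, 1 ≤ m → f (Lc ^ (m + 1)) = f (Lc ^ m) + f Lc)
    (hasym : Tendsto (fun m : ℕ => (f (Lc ^ m) - stepBal N ((Lc : ℝ) ^ m)) / (m : ℝ)) atTop (𝓝 0)) :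
    f Lc = stepBal N Lc := by
  refine value_eq_of_pow_law_littleO (pow_law_of_step_law hstep) ?_
  refine hasym.congr' (Eventually.of_forall fun m => ?_)
  rw [stepBal_natPow]

/-! ## §4 Rate + value ⇒ drift (road A2's last step, by name) -/

/-- [folklore] A geometric rate of `β0` to a limit that EQUALS `s` gives `OneLoopDrift s (c₀/(1−θ)) β0`
(`RateCertificate.GeomRate.drift` after rewriting the limit). -/
theorem oneLoopDrift_of_geomRate_eq {β0 : ℕ → ℝ} {f c₀ θ s : ℝ} (h : GeomRate β0 f c₀ θ) (hθ0 : 0 ≤ θ) (hθ1 : θ < 1)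
    (hval : f = s) : OneLoopDrift s (c₀ / (1 - θ)) β0 := by
  subst hval
  exact h.drift hθ0 hθ1

/-! ## §5 THE ROUTE THEOREM: rate + step law + asymptotics ⇒ drift with slope `stepBal N Lc` -/

/-- **ROAD «FP», COMPOSED (bounded-defect form).**  IF the actual one-loop step coefficients `β0 j` converge at geometric rate to the
`Lc`-member `f Lc` of a family `f` (the perfect step coefficients) [(CONV-C-Cauchy) ⇒ road A2], AND `f` obeys the step law on the powers of
`Lc` [fixed-point Fubini + transport invariance + symmetry class], AND `|f (Lc^m) − stepBal N (Lc^m)| ≤ C` [perfect one-shot asymptotics],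
THEN `OneLoopDrift (stepBal N Lc) (c₀/(1−θ)) β0` — i.e. `D1Drift` once `β0 j := secondMoment (TbalOf Lc Js j) μ ν`.  All three inputs are
HYPOTHESES; this theorem discharges nothing of the wall. -/
theorem oneLoopDrift_stepBal_of_rate_step_law_bounded {β0 : ℕ → ℝ} {f : ℕ → ℝ} {Lc : ℕ} {N c₀ θ C : ℝ}
    (hrate : GeomRate β0 (f Lc) c₀ θ) (hθ0 : 0 ≤ θ) (hθ1 : θ < 1)
    (hstep : ∀ m : ℕ, 1 ≤ m → f (Lc ^ (m + 1)) = f (Lc ^ m) + f Lc)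
    (hasym : ∀ m : ℕ, 1 ≤ m → |f (Lc ^ m) - stepBal N ((Lc : ℝ) ^ m)| ≤ C) :
    OneLoopDrift (stepBal N Lc) (c₀ / (1 - θ)) β0 :=
  oneLoopDrift_of_geomRate_eq hrate hθ0 hθ1 (value_eq_stepBal_of_step_law_bounded hstep hasym)

/-- **ROAD «FP», COMPOSED (mean-law form)**: as above with the asymptotic input weakened to `o(m)`. -/
theorem oneLoopDrift_stepBal_of_rate_step_law_littleO {β0 : ℕ → ℝ} {f : ℕ → ℝ} {Lc : ℕ} {N c₀ θ : ℝ}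
    (hrate : GeomRate β0 (f Lc) c₀ θ) (hθ0 : 0 ≤ θ) (hθ1 : θ < 1)
    (hstep : ∀ m : ℕ, 1 ≤ m → f (Lc ^ (m + 1)) = f (Lc ^ m) + f Lc)
    (hasym : Tendsto (fun m : ℕ => (f (Lc ^ m) - stepBal N ((Lc : ℝ) ^ m)) / (m : ℝ)) atTop (𝓝 0)) :
    OneLoopDrift (stepBal N Lc) (c₀ / (1 - θ)) β0 :=
  oneLoopDrift_of_geomRate_eq hrate hθ0 hθ1 (value_eq_stepBal_of_step_law_littleO hstep hasym)

end Summit.QuantumFields.BalabanUV.Beta.FixedPointIdentification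

/-! ## §6 (v1.1, APPEND-ONLY) THE DEFECTED STEP LAW: road FP as the ARBITER of the wall's limit value (skeleton §7 (r1))

If the one-loop Fubini identity at the fixed point carries a STATIONARY defect `δ` (the second moment of the step defect `D 1` — expected to
vanish for the completed, unipotent-slice family and NOT to vanish for a ghost-less family, RULING (R29)), the step law reads
`f (m+1) = f m + f 1 + δ`; the leading-log asymptotics with slope `s` then force `f 1 + δ = s` — so the road COMPUTES the limit value
`f 1 = s − δ` for ANY stationary-composable family, and `hident` holds iff `δ = 0` (given `s = stepBal`).  Hypotheses only; nothing asserted. -/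

namespace Summit.QuantumFields.BalabanUV.Beta.FixedPointIdentification

open Filter Topology
open Literature.MathematicalPhysics.QuantumFieldTheory.Balaban1983to89

/-- [our object] DEFECTED STEP LAW ⇒ CLOSED FORM: `g (m+1) = g m + g 1 + δ` for `m ≥ 1` gives `g m = m·(g 1 + δ) − δ` for `m ≥ 1`. -/
theorem closed_form_of_defected_step_law {g : ℕ → ℝ} {δ : ℝ} (hstep : ∀ m : ℕ, 1 ≤ m → g (m + 1) = g m + g 1 + δ) :
    ∀ m : ℕ, 1 ≤ m → g m = (m : ℝ) * (g 1 + δ) - δ := by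
  intro m hm
  induction m with
  | zero => exact absurd hm (by norm_num)
  | succ n ih =>
    rcases Nat.eq_zero_or_pos n with h0 | hpos
    · subst h0; simp
    · rw [hstep n hpos, ih hpos]; push_cast; ring

/-- [our object] **DEFECTED STEP LAW + BOUNDED LOG DEFECT ⇒ THE VALUE IS THE SLOPE MINUS THE DEFECT**: `g (m+1) = g m + g 1 + δ` and
`|g m − m·s| ≤ C` for `m ≥ 1` give `g 1 + δ = s`, i.e. `g 1 = s − δ`.  With `δ = 0` this is `value_eq_of_pow_law_bounded`; with `δ ≠ 0` and
`s = stepBal N Lc` it REFUTES `hident` for that family (skeleton §7 (r1)). -/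
theorem value_eq_of_defected_step_law_bounded {g : ℕ → ℝ} {δ s C : ℝ} (hstep : ∀ m : ℕ, 1 ≤ m → g (m + 1) = g m + g 1 + δ)
    (hasym : ∀ m : ℕ, 1 ≤ m → |g m - (m : ℝ) * s| ≤ C) : g 1 = s - δ := by
  have hcl := closed_form_of_defected_step_law hstep
  suffices h : g 1 + δ = s by linarith
  refine eq_of_nat_mul_sub_bounded (C := max (C + |δ|) 0) fun m => ?_
  rcases Nat.eq_zero_or_pos m with h0 | hpos
  · subst h0; simp
  · have h1 := hasym m hpos
    rw [hcl m hpos] at h1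
    have : (m : ℝ) * (g 1 + δ - s) = ((m : ℝ) * (g 1 + δ) - δ - (m : ℝ) * s) + δ := by ring
    rw [this]
    exact ((abs_add_le _ _).trans (by linarith [h1])).trans (le_max_left _ _)

/-- [our object] The mean-law form: `g (m+1) = g m + g 1 + δ` and `(g m − m·s)/m → 0` give `g 1 = s − δ`. -/
theorem value_eq_of_defected_step_law_littleO {g : ℕ → ℝ} {δ s : ℝ} (hstep : ∀ m : ℕ, 1 ≤ m → g (m + 1) = g m + g 1 + δ)
    (hasym : Tendsto (fun m : ℕ => (g m - (m : ℝ) * s) / (m : ℝ)) atTop (𝓝 0)) : g 1 = s - δ := by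
  have hcl := closed_form_of_defected_step_law hstep
  -- `(g m − m s)/m = (g 1 + δ − s) − δ/m` eventually, and `δ/m → 0`
  have hev : (fun m : ℕ => (g m - (m : ℝ) * s) / (m : ℝ)) =ᶠ[atTop] fun m : ℕ => (g 1 + δ - s) - δ / (m : ℝ) := by
    filter_upwards [eventually_ge_atTop 1] with m hm
    have hm' : (m : ℝ) ≠ 0 := by exact_mod_cast (Nat.one_le_iff_ne_zero.mp hm)
    rw [hcl m hm]
    field_simp
    ring
  have hδ : Tendsto (fun m : ℕ => δ / (m : ℝ)) atTop (𝓝 0) := tendsto_const_div_atTop_nhds_zero_nat δ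
  have hlim : Tendsto (fun m : ℕ => (g 1 + δ - s) - δ / (m : ℝ)) atTop (𝓝 ((g 1 + δ - s) - 0)) := tendsto_const_nhds.sub hδ
  have := tendsto_nhds_unique (hasym.congr' hev) hlim
  linarith

end Summit.QuantumFields.BalabanUV.Beta.FixedPointIdentification
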